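import Summits.ResolutionOfSingularities.ResolutionOfSingularities.Theorems.WeightedInvariantIsolatedCoefficient
import Summits.ResolutionOfSingularities.ResolutionOfSingularities.Theorems.WeightedInvariantP3aSpecialFibreFace
import HarnessLib

/-!
# Unit expansions SUPPORTED ON A FACE: a member of `𝒥ₙ(u; w)` (weights may vanish) expands on monomials of `w`-weight `≥ n`
# (door `HypersurfaceCentreConstruction`, stmt-ResolutionOfSingularities-19897, stub `stub_keyRungGrHomLE_three`; tool for (NONREACH-K))

Helper for `stub_keyRungGrHomLE_three` (def-free, `--supports 19897`).  The tree's `LocalGameEFTNewton.exists_unitExpansion` expands any `f`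
on monomials with UNIT coefficients modulo `𝔪^N`, and `le_weight_of_mem_weightedMonomialIdeal` then reads `f ∈ 𝒥ₙ(u; w)` on the exponents —
but only for POSITIVE weights.  The AQS face condition of the curve regime (`q·j + r·i ≥ r·ν` on `x^j y^i z^k`, the parameter `z` of weight
ZERO) is not of that kind.  This file builds the expansion INSIDE the face directly:

* **`LocalGameEFTNewton.exists_unitExpansion_of_mem_weightedMonomialIdeal`** — `S` local, `𝔪 = (u₁, …, u_d)`, ANY weights `w : Fin d → ℕ`
  (zeros allowed), `f ∈ 𝒥ₙ(u; w)`: for every `N` there are a finite exponent set `Δ` with `w·α ≥ n` on `Δ`, UNIT coefficients, and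
  `f ≡ Σ_{α ∈ Δ} a_α u^α (mod 𝔪^N)`.  Proof: write `f` on the generating monomials (`exists_finsupp_of_mem_weightedMonomialIdeal`) and NORMALISE
  degree by degree — a non-unit coefficient `C ∈ 𝔪 = (u)` is re-expanded one degree up (`C·u^E = Σᵢ cᵢ·u^{E+eᵢ}`, exponents stay in the
  face since it is upward closed); after `N` rounds every coefficient of degree `< N` is a unit and the rest lies in `𝔪^N`.
* **`LocalGameEFTNewton.exists_faceExpansion_three`** — the instance used by (NONREACH-K): `f ∈ 𝒥_{rν}((y, x); (r, q))` in a local ring with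
  `𝔪 = (x, y, z)` expands, modulo `𝔪^N`, on monomials `x^j y^i z^k` with unit coefficients and `r·ν ≤ q·j + r·i`.

[OURS · L1 W4.3 · kernel lemma; AI work, weaker than expert review; nothing here is a statement of the manuscript under review
(Hironaka 2017, [claim: Hironaka2017, status: under-review]).]

## References

* J. Włodarczyk, *Functorial resolution by torus actions*, arXiv:2203.03090, Lemma 2.1.12 (the monomial ideals `𝒥ₙ`). [Wlodarczyk2022]
-/

noncomputable section

set_option linter.dupNamespace false -- mandated namespace of this single-conjunct summit

open IsLocalRing Literature.AlgebraicGeometry.Resolution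

namespace Summit.ResolutionOfSingularities.ResolutionOfSingularities.Theorems

namespace LocalGameEFTNewton

variable {S : Type} [CommRing S] [IsLocalRing S] {d : ℕ} (u : Fin d → S) (hu : Ideal.span (Set.range u) = maximalIdeal S)
  (w : Fin d → ℕ)

include hu in
/-- **Normalisation of a face-supported expansion, degree by degree.**  For every `m`: a finsupp expansion `f ≡ Σ l(E)·u^E (mod 𝔪^N)` with
support in the face `{w·E ≥ n}` and UNIT coefficients in all degrees `< m`. [cite: Wlodarczyk2022, Lemma 2.1.12] -/
theorem exists_finsupp_units_below {n N : ℕ} {f : S} (hf : f ∈ weightedMonomialIdeal u w n) (m : ℕ) :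
    ∃ l : (Fin d → ℕ) →₀ S, (∀ E ∈ l.support, n ≤ ∑ i, w i * E i) ∧ (∀ E ∈ l.support, ∑ i, E i < m → IsUnit (l E)) ∧
      f - ∑ E ∈ l.support, l E * ∏ i, u i ^ E i ∈ maximalIdeal S ^ N := by
  classical
  induction m with
  | zero =>
    obtain ⟨l, hl, hf⟩ := LocalGameEFTCylinder.exists_finsupp_of_mem_weightedMonomialIdeal u w hf
    exact ⟨l, hl, fun E _ h => absurd h (Nat.not_lt_zero _), by rw [← hf, sub_self]; exact Submodule.zero_mem _⟩
  | succ m ih =>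
    obtain ⟨l, hface, hunit, hr⟩ := ih
    -- the degree-`m` exponents with a non-unit coefficient
    set F : Finset (Fin d → ℕ) := l.support.filter (fun E => ∑ i, E i = m ∧ ¬ IsUnit (l E)) with hF
    have hc : ∀ E, ∃ c : Fin d → S, E ∈ F → ∑ i, c i * u i = l E := by
      intro E
      by_cases hE : E ∈ F
      · have h : l E ∈ Ideal.span (Set.range u) := by
          rw [hu]; exact (IsLocalRing.mem_maximalIdeal _).mpr (Finset.mem_filter.mp hE).2.2
        obtain ⟨c, hc⟩ := Ideal.mem_span_range_iff_exists_fun.mp h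
        exact ⟨c, fun _ => hc⟩
      · exact ⟨0, fun h => absurd h hE⟩
    choose c hc using hc
    set l' : (Fin d → ℕ) →₀ S := l - ∑ E ∈ F, Finsupp.single E (l E) +
      ∑ E ∈ F, ∑ i, Finsupp.single (E + Pi.single i 1) (c E i) with hl'
    -- value unchanged
    have hval : ∀ l₁ : (Fin d → ℕ) →₀ S, ∑ E ∈ l₁.support, l₁ E * ∏ i, u i ^ E i =
        Finsupp.linearCombination S (fun E : Fin d → ℕ => ∏ i, u i ^ E i) l₁ := fun l₁ => by
      rw [Finsupp.linearCombination_apply, Finsupp.sum]; rfl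
    have hsame : ∑ E ∈ l'.support, l' E * ∏ i, u i ^ E i = ∑ E ∈ l.support, l E * ∏ i, u i ^ E i := by
      rw [hval, hval, hl', map_add, map_sub, map_sum, map_sum]
      simp only [map_sum, Finsupp.linearCombination_single, smul_eq_mul]
      have h1 : ∀ E ∈ F, ∑ i, c E i * ∏ j, u j ^ (E + Pi.single i 1 : Fin d → ℕ) j = l E * ∏ j, u j ^ E j := fun E hE => by
        simp_rw [prod_pow_add_single u, ← mul_assoc, mul_comm (c E _) (∏ j, u j ^ E j), mul_assoc, ← Finset.mul_sum, hc E hE]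
        ring
      rw [Finset.sum_congr rfl h1]
      ring
    -- pointwise description
    have happly : ∀ E' : Fin d → ℕ, l' E' = l E' - (∑ E ∈ F, Finsupp.single E (l E)) E' +
        ∑ E ∈ F, ∑ i, (Finsupp.single (E + Pi.single i 1) (c E i)) E' := fun E' => by
      rw [hl']
      simp only [Finsupp.add_apply, Finsupp.sub_apply, Finsupp.finsetSum_apply]
    have hlayer_apply : ∀ E', (∑ E ∈ F, Finsupp.single E (l E)) E' = if E' ∈ F then l E' else 0 := fun E' => by
      simp only [Finsupp.finsetSum_apply, Finsupp.single_apply, Finset.sum_ite_eq']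
    have hbump_zero : ∀ E', (∀ E ∈ F, ∀ i, E + Pi.single i 1 ≠ E') →
        ∑ E ∈ F, ∑ i, (Finsupp.single (E + Pi.single i 1) (c E i)) E' = 0 := fun E' h =>
      Finset.sum_eq_zero fun E hE => Finset.sum_eq_zero fun i _ => by rw [Finsupp.single_apply, if_neg (h E hE i)]
    have hdeg_bump : ∀ (E : Fin d → ℕ) (i : Fin d), ∑ j, (E + Pi.single i 1 : Fin d → ℕ) j = ∑ j, E j + 1 := fun E i => by
      simp only [Pi.add_apply, Finset.sum_add_distrib, Pi.single_apply, Finset.sum_ite_eq', Finset.mem_univ, if_true]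
    have hw_bump : ∀ (E : Fin d → ℕ) (i : Fin d), ∑ j, w j * E j ≤ ∑ j, w j * (E + Pi.single i 1 : Fin d → ℕ) j := fun E i =>
      Finset.sum_le_sum fun j _ => Nat.mul_le_mul_left _ (by simp only [Pi.add_apply]; exact Nat.le_add_right _ _)
    have hsupp : ∀ E' ∈ l'.support, (E' ∈ l.support ∧ E' ∉ F) ∨ ∃ E ∈ F, ∃ i, E + Pi.single i 1 = E' := by
      intro E' hE'
      by_contra hnot
      push Not at hnot
      apply Finsupp.mem_support_iff.mp hE'
      rw [happly, hbump_zero E' (fun E hE i h => (hnot.2 E hE i) h), add_zero, hlayer_apply]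
      split_ifs with hE'F
      · exact sub_self _
      · rw [sub_zero]
        by_contra hne
        exact hE'F (hnot.1 (Finsupp.mem_support_iff.mpr hne))
    -- coefficients of small degree outside `F` are unchanged
    have hkeep : ∀ E', ∑ j, E' j ≤ m → E' ∉ F → l' E' = l E' := by
      intro E' hdeg hE'F
      rw [happly, hlayer_apply, if_neg hE'F, sub_zero, hbump_zero E', add_zero]
      intro E hE i h
      have h1 := hdeg_bump E i
      rw [h] at h1
      have h2 := (Finset.mem_filter.mp hE).2.1
      omega
    refine ⟨l', ?_, ?_, by rw [hsame]; exact hr⟩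
    · intro E' hE'
      rcases hsupp E' hE' with ⟨hE's, -⟩ | ⟨E, hE, i, rfl⟩
      · exact hface E' hE's
      · exact (hface E (Finset.mem_filter.mp hE).1).trans (hw_bump E i)
    · intro E' hE' hdeg
      rcases hsupp E' hE' with ⟨hE's, hE'F⟩ | ⟨E, hE, i, rfl⟩
      · rw [hkeep E' (by omega) hE'F]
        by_cases hlt : ∑ j, E' j < m
        · exact hunit E' hE's hlt
        · have heq : ∑ j, E' j = m := by omega
          by_contra hnu
          exact hE'F (Finset.mem_filter.mpr ⟨hE's, heq, hnu⟩)
      · exfalso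
        have h1 := hdeg_bump E i
        have h2 := (Finset.mem_filter.mp hE).2.1
        omega

include hu in
/-- **Unit expansion supported on a face.**  `S` local with `𝔪 = (u₁, …, u_d)`, weights `w : Fin d → ℕ` (zero weights allowed),
`f ∈ 𝒥ₙ(u; w)`.  Then for every `N`: `f ≡ Σ_{α ∈ Δ} a_α u^α (mod 𝔪^N)` with UNIT coefficients and every exponent of `Δ` of `w`-weight `≥ n`.
[cite: Wlodarczyk2022, Lemma 2.1.12] -/
theorem exists_unitExpansion_of_mem_weightedMonomialIdeal {n : ℕ} {f : S} (hf : f ∈ weightedMonomialIdeal u w n) (N : ℕ) :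
    ∃ (Δ : Finset (Fin d → ℕ)) (a : (Fin d → ℕ) → S),
      (∀ α ∈ Δ, IsUnit (a α)) ∧ (∀ α ∈ Δ, n ≤ ∑ i, w i * α i) ∧
        f - ∑ α ∈ Δ, a α * ∏ i, u i ^ α i ∈ maximalIdeal S ^ N := by
  classical
  obtain ⟨l, hface, hunit, hr⟩ := exists_finsupp_units_below u hu w (N := N) hf N
  refine ⟨l.support.filter (fun E => ∑ i, E i < N), l, fun α hα => hunit α (Finset.mem_filter.mp hα).1 (Finset.mem_filter.mp hα).2,
    fun α hα => hface α (Finset.mem_filter.mp hα).1, ?_⟩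
  have hsplit := Finset.sum_filter_add_sum_filter_not l.support (fun E => ∑ i, E i < N) (fun E => l E * ∏ i, u i ^ E i)
  have hhigh : ∑ E ∈ l.support.filter (fun E => ¬ ∑ i, E i < N), l E * ∏ i, u i ^ E i ∈ maximalIdeal S ^ N :=
    Ideal.sum_mem _ fun E hE => Ideal.mul_mem_left _ _
      (Ideal.pow_le_pow_right (Nat.le_of_not_lt (Finset.mem_filter.mp hE).2) (prod_pow_mem_pow u hu E))
  have heq : f - ∑ E ∈ l.support.filter (fun E => ∑ i, E i < N), l E * ∏ i, u i ^ E i =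
      (f - ∑ E ∈ l.support, l E * ∏ i, u i ^ E i) + ∑ E ∈ l.support.filter (fun E => ¬ ∑ i, E i < N), l E * ∏ i, u i ^ E i := by
    rw [← hsplit]; ring
  rw [heq]
  exact Ideal.add_mem _ hr hhigh

/-- **The AQS-face expansion in the frame `(x, y, z)`.**  `S` local with `𝔪 = (x, y, z)`; `f ∈ 𝒥_{rν}((y, x); (r, q))`.  Then for every `N`:
`f ≡ Σ_{γ ∈ Δ} a_γ x^{γ₀} y^{γ₁} z^{γ₂} (mod 𝔪^N)` with UNIT coefficients and `r·ν ≤ q·γ₀ + r·γ₁` on `Δ` (the face condition; `z` has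
weight zero). [OURS · L1 W4.3] [cite: Wlodarczyk2022, Lemma 2.1.12] -/
theorem exists_faceExpansion_three {x y z : S} (hxyz : Ideal.span {x, y, z} = maximalIdeal S) {q r ν : ℕ} {f : S}
    (hf : f ∈ weightedMonomialIdeal ![y, x] ![r, q] (r * ν)) (N : ℕ) :
    ∃ (Δ : Finset (Fin 3 → ℕ)) (a : (Fin 3 → ℕ) → S),
      (∀ γ ∈ Δ, IsUnit (a γ)) ∧ (∀ γ ∈ Δ, r * ν ≤ q * γ 0 + r * γ 1) ∧
        f - ∑ γ ∈ Δ, a γ * ∏ i, ![x, y, z] i ^ γ i ∈ maximalIdeal S ^ N := by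
  classical
  have hu : Ideal.span (Set.range ![x, y, z]) = maximalIdeal S := by
    rw [Matrix.range_cons, Matrix.range_cons, Matrix.range_cons, Matrix.range_empty, Set.union_empty, Set.singleton_union,
      Set.singleton_union]
    exact hxyz
  -- `𝒥_{rν}((y,x);(r,q)) ≤ 𝒥_{rν}((x,y,z);(q,r,0))`
  have hle : weightedMonomialIdeal ![y, x] ![r, q] (r * ν) ≤ weightedMonomialIdeal ![x, y, z] ![q, r, 0] (r * ν) := by
    rw [weightedMonomialIdeal, Ideal.span_le]
    rintro m ⟨α, hα, rfl⟩
    refine Ideal.subset_span ⟨![α 1, α 0, 0], ?_, ?_⟩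
    · simp only [Fin.sum_univ_two, Fin.sum_univ_three, Matrix.cons_val_zero, Matrix.cons_val_one, Matrix.cons_val_two,
        Matrix.tail_cons, Matrix.head_cons] at hα ⊢
      omega
    · simp only [Fin.prod_univ_two, Fin.prod_univ_three, Matrix.cons_val_zero, Matrix.cons_val_one, Matrix.cons_val_two,
        Matrix.tail_cons, Matrix.head_cons, pow_zero, mul_one]
      ring
  obtain ⟨Δ, a, hunit, hface, hr⟩ := exists_unitExpansion_of_mem_weightedMonomialIdeal ![x, y, z] hu ![q, r, 0] (hle hf) N
  refine ⟨Δ, a, hunit, fun γ hγ => ?_, hr⟩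
  have h := hface γ hγ
  simp only [Fin.sum_univ_three, Matrix.cons_val_zero, Matrix.cons_val_one, Matrix.cons_val_two, Matrix.tail_cons,
    Matrix.head_cons, zero_mul, add_zero] at h
  exact h

end LocalGameEFTNewton

end Summit.ResolutionOfSingularities.ResolutionOfSingularities.Theorems

end
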